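import Summits.CriticalPhenomena.PercolationContinuityZ3.Theorems.PercNearOneGluingNoHeavyLowerTailKnQuestion8CoefficientwiseRootEdgeDomination
import HarnessLib

/-!
# (REM) from the four PIECE ROWS of `G − e` — the top reduction of THEOREM SP (series–parallel root blocks) — prim-lf-2 gen 69

Support file (`--supports stmt-CriticalPhenomena-4575`, closed), prover `prim-lf-2` (gen 69).  No definitions, no named facts, no sorries; standard axioms.
Memo `prim-lf-2/CW-SP-gen69.md` §1–§2 (THEOREM 0).

Setting (CONJECTURE (REM), prim-lf-2 gen 66; `…CoefficientwiseRootEdgeDomination`): multigraph `ends : ι → Sym2 V`, edge set `E`, root `x`, root edge `e ∈ E` with ends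
`{x,p}`, targets `W`; `REM_E(e;x,W)[g] = Σ_{s ⊆ E : e ∈ s, ∀ w∈W ¬(w ∈ C_x s ∧ w ∈ C_x(E∖s))} (g(C_x s) − g(C_x(E∖s)))`.  On the PIECE `D = E.erase e` (terminals `x`, `p`)
write, for `t ⊆ D`, `K₀ = C_x(t)`, `P = C_p(t)`, `B₀ = C_x(D∖t)`, `P' = C_p(D∖t)` (the four clusters `A^x, A^h, B^x, B^h` of memo §1) and `F(t) = g(K₀ ∪ P) − g(B₀)`.
THEOREM SP (memo §5) says `REM ≥ 0` whenever `D` is a two-terminal series–parallel graph; its proof is (a) THIS FILE: `REM ≥ 0` follows from four linear PIECE ROWS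
of `D` — the classes `R1` (red-through, no `x`-core, some target of the red cluster blue-joined to `p`), `R0` (red-through, no flags; only needed when `p ∈ W`),
`N0`/`N1` (mixed: `p ∉ K₀ ∪ B₀`, no target in `(K₀ ∪ P) ∩ B₀`, some target in `K₀ ∩ P'`, split by targets in `P ∩ P'`) — and (b) an induction over the series–parallel
decomposition showing the four rows for every SP piece (memo §4, machine-certified; Lean to follow).
* `Coefficientwise.rem_nonneg_of_pieceRows` — **THEOREM 0**: the four row inequalities for `D = E.erase e` imply `0 ≤ REM_E(e;x,W)[g]` for monotone `g`.
  Proof: resolve `e` (`rem_eq_sum_erase`); on the complement-closed part of the event the colour swap `t ↦ D∖t` reindexes `Σ g(B₀)` into `Σ g(K₀) ≤ Σ g(K₀ ∪ P)`;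
  the residual (event holds for `t` but not for `D∖t`) is exactly `R1 ⊔ [p∈W]·R0 ⊔ N0 ⊔ N1`.
[cite: KozmaNitzan2024, Questions 8–9 (§5.5 p. 36) (context: the Question-8 pocket covariance programme)]
-/

namespace Summit.CriticalPhenomena.PercolationContinuityZ3.Theorems

open Finset Literature.Probability.Percolation

namespace Coefficientwise

variable {ι V : Type*} [DecidableEq ι] (ends : ι → Sym2 V)

section pieceRows

open Classical in
/-- **THEOREM 0 (REM from the piece rows).**  Let `e ∈ E` have ends `{x,p}`, `p ≠ x`, `D = E.erase e`, `K₀ = C_x t`, `P = C_p t`, `B₀ = C_x(D∖t)`, `P' = C_p(D∖t)`,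
`F t = g(K₀ ∪ P) − g(B₀)`, `g` monotone.  Assume the four PIECE ROWS of `D` (each a sum of `F` over a colouring class of `D`, memo CW-SP-gen69 §1):
`R1`: `0 ≤ Σ_{p∈K₀, p∉B₀, ∀w∈W ¬(w∈K₀∧w∈B₀), ∃w∈W, w≠p ∧ w∈K₀ ∧ w∈P'} F`;  `R0` (only if `p ∈ W`): `0 ≤ Σ_{p∈K₀, p∉B₀, ∀w∈W ¬(w∈K₀∧w∈B₀), ∀w∈W, w≠p → ¬(w∈K₀∧w∈P')} F`;
`N0`/`N1`: `0 ≤ Σ_{p∉K₀, p∉B₀, ∀w∈W ¬(w∈K₀∧w∈B₀), ∀w∈W ¬(w∈P∧w∈B₀), ∃w∈W, w∈K₀∧w∈P', [¬ / ∃] (w∈W, w≠p, w∈P∧w∈P')} F`.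
Then `0 ≤ REM_E(e; x, W)[g]`. [cite: KozmaNitzan2024, Questions 8–9 (§5.5 p. 36) (context)] -/
theorem rem_nonneg_of_pieceRows (E : Finset ι) {e : ι} (he : e ∈ E) {x p : V} (hxp : ends e = s(x, p)) (hpx : p ≠ x)
    (W : Set V) (g : Set V → ℝ) (hg : Monotone g)
    (hR1 : 0 ≤ ∑ t ∈ (E.erase e).powerset.filter (fun t : Finset ι =>
          p ∈ openCluster (ends '' (↑t : Set ι)) x ∧ p ∉ openCluster (ends '' (↑((E.erase e) \ t) : Set ι)) x ∧
          (∀ w ∈ W, ¬ (w ∈ openCluster (ends '' (↑t : Set ι)) x ∧ w ∈ openCluster (ends '' (↑((E.erase e) \ t) : Set ι)) x)) ∧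
          (∃ w ∈ W, w ≠ p ∧ w ∈ openCluster (ends '' (↑t : Set ι)) x ∧ w ∈ openCluster (ends '' (↑((E.erase e) \ t) : Set ι)) p)),
        (g (openCluster (ends '' (↑t : Set ι)) x ∪ openCluster (ends '' (↑t : Set ι)) p) -
          g (openCluster (ends '' (↑((E.erase e) \ t) : Set ι)) x)))
    (hR0 : p ∈ W → 0 ≤ ∑ t ∈ (E.erase e).powerset.filter (fun t : Finset ι =>
          p ∈ openCluster (ends '' (↑t : Set ι)) x ∧ p ∉ openCluster (ends '' (↑((E.erase e) \ t) : Set ι)) x ∧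
          (∀ w ∈ W, ¬ (w ∈ openCluster (ends '' (↑t : Set ι)) x ∧ w ∈ openCluster (ends '' (↑((E.erase e) \ t) : Set ι)) x)) ∧
          (∀ w ∈ W, w ≠ p → ¬ (w ∈ openCluster (ends '' (↑t : Set ι)) x ∧ w ∈ openCluster (ends '' (↑((E.erase e) \ t) : Set ι)) p))),
        (g (openCluster (ends '' (↑t : Set ι)) x ∪ openCluster (ends '' (↑t : Set ι)) p) -
          g (openCluster (ends '' (↑((E.erase e) \ t) : Set ι)) x)))
    (hN0 : 0 ≤ ∑ t ∈ (E.erase e).powerset.filter (fun t : Finset ι =>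
          p ∉ openCluster (ends '' (↑t : Set ι)) x ∧ p ∉ openCluster (ends '' (↑((E.erase e) \ t) : Set ι)) x ∧
          (∀ w ∈ W, ¬ (w ∈ openCluster (ends '' (↑t : Set ι)) x ∧ w ∈ openCluster (ends '' (↑((E.erase e) \ t) : Set ι)) x)) ∧
          (∀ w ∈ W, ¬ (w ∈ openCluster (ends '' (↑t : Set ι)) p ∧ w ∈ openCluster (ends '' (↑((E.erase e) \ t) : Set ι)) x)) ∧
          (∃ w ∈ W, w ∈ openCluster (ends '' (↑t : Set ι)) x ∧ w ∈ openCluster (ends '' (↑((E.erase e) \ t) : Set ι)) p) ∧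
          (∀ w ∈ W, w ≠ p → ¬ (w ∈ openCluster (ends '' (↑t : Set ι)) p ∧ w ∈ openCluster (ends '' (↑((E.erase e) \ t) : Set ι)) p))),
        (g (openCluster (ends '' (↑t : Set ι)) x ∪ openCluster (ends '' (↑t : Set ι)) p) -
          g (openCluster (ends '' (↑((E.erase e) \ t) : Set ι)) x)))
    (hN1 : 0 ≤ ∑ t ∈ (E.erase e).powerset.filter (fun t : Finset ι =>
          p ∉ openCluster (ends '' (↑t : Set ι)) x ∧ p ∉ openCluster (ends '' (↑((E.erase e) \ t) : Set ι)) x ∧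
          (∀ w ∈ W, ¬ (w ∈ openCluster (ends '' (↑t : Set ι)) x ∧ w ∈ openCluster (ends '' (↑((E.erase e) \ t) : Set ι)) x)) ∧
          (∀ w ∈ W, ¬ (w ∈ openCluster (ends '' (↑t : Set ι)) p ∧ w ∈ openCluster (ends '' (↑((E.erase e) \ t) : Set ι)) x)) ∧
          (∃ w ∈ W, w ∈ openCluster (ends '' (↑t : Set ι)) x ∧ w ∈ openCluster (ends '' (↑((E.erase e) \ t) : Set ι)) p) ∧
          (∃ w ∈ W, w ≠ p ∧ w ∈ openCluster (ends '' (↑t : Set ι)) p ∧ w ∈ openCluster (ends '' (↑((E.erase e) \ t) : Set ι)) p)),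
        (g (openCluster (ends '' (↑t : Set ι)) x ∪ openCluster (ends '' (↑t : Set ι)) p) -
          g (openCluster (ends '' (↑((E.erase e) \ t) : Set ι)) x))) :
    0 ≤ ∑ s ∈ E.powerset.filter (fun s : Finset ι => e ∈ s ∧
          ∀ w ∈ W, ¬ (w ∈ openCluster (ends '' (↑s : Set ι)) x ∧ w ∈ openCluster (ends '' (↑(E \ s) : Set ι)) x)),
      (g (openCluster (ends '' (↑s : Set ι)) x) - g (openCluster (ends '' (↑(E \ s) : Set ι)) x)) := by
  rw [rem_eq_sum_erase ends E he hxp hpx W g]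
  set D : Finset ι := E.erase e with hD
  -- abbreviations: K t = C_x(t), Pc t = C_p(t); B₀ = K (D \ t), P' = Pc (D \ t)
  set K : Finset ι → Set V := fun t => openCluster (ends '' (↑t : Set ι)) x with hK
  set Pc : Finset ι → Set V := fun t => openCluster (ends '' (↑t : Set ι)) p with hPc
  set F : Finset ι → ℝ := fun t => g (K t ∪ Pc t) - g (K (D \ t)) with hF
  -- the event and its colour swap
  set Ev : Finset ι → Prop := fun t => ∀ w ∈ W, ¬ (w ∈ K t ∪ Pc t ∧ w ∈ K (D \ t)) with hEv
  set Ev' : Finset ι → Prop := fun t => ∀ w ∈ W, ¬ (w ∈ K (D \ t) ∪ Pc (D \ t) ∧ w ∈ K t) with hEv'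
  change 0 ≤ ∑ t ∈ D.powerset.filter Ev, F t
  -- basic cluster facts
  have hPsubK : ∀ t : Finset ι, p ∈ K t → Pc t ⊆ K t := fun t hp => openCluster_subset_of_mem ends hp
  have hpP : ∀ t : Finset ι, p ∈ Pc t := fun t => mem_openCluster_self _ p
  -- split off the complement-closed part
  have hsplit : ∑ t ∈ D.powerset.filter Ev, F t =
      ∑ t ∈ D.powerset.filter (fun t => Ev t ∧ Ev' t), F t + ∑ t ∈ D.powerset.filter (fun t => Ev t ∧ ¬ Ev' t), F t := by
    rw [← Finset.filter_filter, ← Finset.filter_filter, Finset.sum_filter_add_sum_filter_not]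
  -- PART S: the complement-closed part is ≥ 0 by the colour swap
  have hS : 0 ≤ ∑ t ∈ D.powerset.filter (fun t => Ev t ∧ Ev' t), F t := by
    have hsym : ∀ s, s ⊆ D → ((Ev (D \ s) ∧ Ev' (D \ s)) ↔ (Ev s ∧ Ev' s)) := by
      intro s hs
      have h1 : Ev (D \ s) ↔ Ev' s := by
        simp only [hEv, hEv', Finset.sdiff_sdiff_eq_self hs]
      have h2 : Ev' (D \ s) ↔ Ev s := by
        simp only [hEv, hEv', Finset.sdiff_sdiff_eq_self hs]
      rw [h1, h2]; exact and_comm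
    have hflip := sum_powerset_filter_sdiff (E := D) (Q := fun t => Ev t ∧ Ev' t) hsym (fun t => g (K t))
    have hrew : ∑ t ∈ D.powerset.filter (fun t => Ev t ∧ Ev' t), F t =
        ∑ t ∈ D.powerset.filter (fun t => Ev t ∧ Ev' t), (g (K t ∪ Pc t) - g (K t)) := by
      simp only [hF]
      rw [Finset.sum_sub_distrib, Finset.sum_sub_distrib, hflip]
    rw [hrew]
    exact Finset.sum_nonneg fun t _ => sub_nonneg.mpr (hg Set.subset_union_left)
  -- the residual: Ev t ∧ ¬ Ev' t.  First consequences.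
  have res_nb : ∀ t : Finset ι, Ev t → ¬ Ev' t → p ∉ K (D \ t) := by
    intro t hEvt hnEv' hpB
    apply hnEv'
    intro w hw hh
    obtain ⟨hw1, hw2⟩ := hh
    have hwB : w ∈ K (D \ t) := by
      rcases hw1 with h1 | h1
      · exact h1
      · exact hPsubK (D \ t) hpB h1
    exact hEvt w hw ⟨Or.inl hw2, hwB⟩
  have res_wit : ∀ t : Finset ι, Ev t → ¬ Ev' t → ∃ w ∈ W, w ∈ K t ∧ w ∈ Pc (D \ t) := by
    intro t hEvt hnEv'
    by_contra hne
    push Not at hne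
    apply hnEv'
    intro w hw hh
    obtain ⟨hw1, hw2⟩ := hh
    rcases hw1 with h1 | h1
    · exact hEvt w hw ⟨Or.inl hw2, h1⟩
    · exact hne w hw hw2 h1
  -- class predicates
  set ρ : Finset ι → Prop := fun t => p ∈ K t with hρ
  set fxh : Finset ι → Prop := fun t => ∃ w ∈ W, w ≠ p ∧ w ∈ K t ∧ w ∈ Pc (D \ t) with hfxh
  set fhh : Finset ι → Prop := fun t => ∃ w ∈ W, w ≠ p ∧ w ∈ Pc t ∧ w ∈ Pc (D \ t) with hfhh
  set cR1 : Finset ι → Prop := fun t => p ∈ K t ∧ p ∉ K (D \ t) ∧ (∀ w ∈ W, ¬ (w ∈ K t ∧ w ∈ K (D \ t))) ∧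
      (∃ w ∈ W, w ≠ p ∧ w ∈ K t ∧ w ∈ Pc (D \ t)) with hcR1
  set cR0 : Finset ι → Prop := fun t => p ∈ K t ∧ p ∉ K (D \ t) ∧ (∀ w ∈ W, ¬ (w ∈ K t ∧ w ∈ K (D \ t))) ∧
      (∀ w ∈ W, w ≠ p → ¬ (w ∈ K t ∧ w ∈ Pc (D \ t))) with hcR0
  set cN : Finset ι → Prop := fun t => p ∉ K t ∧ p ∉ K (D \ t) ∧ (∀ w ∈ W, ¬ (w ∈ K t ∧ w ∈ K (D \ t))) ∧
      (∀ w ∈ W, ¬ (w ∈ Pc t ∧ w ∈ K (D \ t))) ∧ (∃ w ∈ W, w ∈ K t ∧ w ∈ Pc (D \ t)) with hcN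
  set cN0 : Finset ι → Prop := fun t => cN t ∧ (∀ w ∈ W, w ≠ p → ¬ (w ∈ Pc t ∧ w ∈ Pc (D \ t))) with hcN0
  set cN1 : Finset ι → Prop := fun t => cN t ∧ (∃ w ∈ W, w ≠ p ∧ w ∈ Pc t ∧ w ∈ Pc (D \ t)) with hcN1
  change 0 ≤ ∑ t ∈ D.powerset.filter cR1, F t at hR1
  change p ∈ W → 0 ≤ ∑ t ∈ D.powerset.filter cR0, F t at hR0
  have hN0' : 0 ≤ ∑ t ∈ D.powerset.filter cN0, F t := by
    refine le_of_le_of_eq hN0 (Finset.sum_congr ?_ fun _ _ => rfl)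
    refine Finset.filter_congr fun t _ => ?_
    simp only [hcN0, hcN, and_assoc]
    exact Iff.rfl
  have hN1' : 0 ≤ ∑ t ∈ D.powerset.filter cN1, F t := by
    refine le_of_le_of_eq hN1 (Finset.sum_congr ?_ fun _ _ => rfl)
    refine Finset.filter_congr fun t _ => ?_
    simp only [hcN1, hcN, and_assoc]
    exact Iff.rfl
  -- residual ∧ ρ ∧ fxh  =  class R1
  have eqR1 : ∀ t : Finset ι, ((Ev t ∧ ¬ Ev' t) ∧ ρ t) ∧ fxh t ↔ cR1 t := by
    intro t; constructor
    · rintro ⟨⟨⟨hEvt, hnEv'⟩, hr⟩, hf⟩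
      exact ⟨hr, res_nb t hEvt hnEv', fun w hw hh => hEvt w hw ⟨Or.inl hh.1, hh.2⟩, hf⟩
    · rintro ⟨hr, hnb, hEvK, hf⟩
      refine ⟨⟨⟨fun w hw hh => ?_, fun hEv't => ?_⟩, hr⟩, hf⟩
      · obtain ⟨hw1, hw2⟩ := hh
        rcases hw1 with h1 | h1
        · exact hEvK w hw ⟨h1, hw2⟩
        · exact hEvK w hw ⟨hPsubK t hr h1, hw2⟩
      · obtain ⟨w, hw, -, hwK, hwP'⟩ := hf
        exact hEv't w hw ⟨Or.inr hwP', hwK⟩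
  -- residual ∧ ρ ∧ ¬fxh  =  [p ∈ W] ∧ class R0
  have eqR0 : ∀ t : Finset ι, ((Ev t ∧ ¬ Ev' t) ∧ ρ t) ∧ ¬ fxh t ↔ (p ∈ W ∧ cR0 t) := by
    intro t; constructor
    · rintro ⟨⟨⟨hEvt, hnEv'⟩, hr⟩, hnf⟩
      have hnf' : ∀ w ∈ W, w ≠ p → ¬ (w ∈ K t ∧ w ∈ Pc (D \ t)) := fun w hw hne hh => hnf ⟨w, hw, hne, hh.1, hh.2⟩
      obtain ⟨w, hw, hwK, hwP'⟩ := res_wit t hEvt hnEv'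
      have hwp : w = p := by
        by_contra hne
        exact hnf' w hw hne ⟨hwK, hwP'⟩
      refine ⟨hwp ▸ hw, hr, res_nb t hEvt hnEv', fun w hw hh => hEvt w hw ⟨Or.inl hh.1, hh.2⟩, hnf'⟩
    · rintro ⟨hpW, hr, hnb, hEvK, hnf'⟩
      refine ⟨⟨⟨fun w hw hh => ?_, fun hEv't => hEv't p hpW ⟨Or.inr (hpP (D \ t)), hr⟩⟩, hr⟩, fun hf => ?_⟩
      · obtain ⟨hw1, hw2⟩ := hh
        rcases hw1 with h1 | h1
        · exact hEvK w hw ⟨h1, hw2⟩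
        · exact hEvK w hw ⟨hPsubK t hr h1, hw2⟩
      · obtain ⟨w, hw, hne, hwK, hwP'⟩ := hf
        exact hnf' w hw hne ⟨hwK, hwP'⟩
  -- residual ∧ ¬ρ  =  class N (then split by fhh)
  have eqN : ∀ t : Finset ι, (Ev t ∧ ¬ Ev' t) ∧ ¬ ρ t ↔ cN t := by
    intro t; constructor
    · rintro ⟨⟨hEvt, hnEv'⟩, hnr⟩
      obtain ⟨w, hw, hwK, hwP'⟩ := res_wit t hEvt hnEv'
      exact ⟨hnr, res_nb t hEvt hnEv', fun w hw hh => hEvt w hw ⟨Or.inl hh.1, hh.2⟩,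
        fun w hw hh => hEvt w hw ⟨Or.inr hh.1, hh.2⟩, ⟨w, hw, hwK, hwP'⟩⟩
    · rintro ⟨hnr, hnb, hEvK, hEvP, ⟨w, hw, hwK, hwP'⟩⟩
      refine ⟨⟨fun w hw hh => ?_, fun hEv't => hEv't w hw ⟨Or.inr hwP', hwK⟩⟩, hnr⟩
      obtain ⟨hw1, hw2⟩ := hh
      rcases hw1 with h1 | h1
      · exact hEvK w hw ⟨h1, hw2⟩
      · exact hEvP w hw ⟨h1, hw2⟩
  have eqN0 : ∀ t : Finset ι, ((Ev t ∧ ¬ Ev' t) ∧ ¬ ρ t) ∧ ¬ fhh t ↔ cN0 t := by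
    intro t
    rw [eqN t]
    simp only [hcN0, hfhh]
    constructor
    · rintro ⟨hN, hnf⟩; exact ⟨hN, fun w hw hne hh => hnf ⟨w, hw, hne, hh.1, hh.2⟩⟩
    · rintro ⟨hN, hnf'⟩; exact ⟨hN, fun ⟨w, hw, hne, h1, h2⟩ => hnf' w hw hne ⟨h1, h2⟩⟩
  have eqN1 : ∀ t : Finset ι, ((Ev t ∧ ¬ Ev' t) ∧ ¬ ρ t) ∧ fhh t ↔ cN1 t := by
    intro t
    rw [eqN t]
  -- assemble the residual
  have hRes : 0 ≤ ∑ t ∈ D.powerset.filter (fun t => Ev t ∧ ¬ Ev' t), F t := by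
    -- split by ρ
    rw [← Finset.sum_filter_add_sum_filter_not (D.powerset.filter (fun t => Ev t ∧ ¬ Ev' t)) ρ, Finset.filter_filter, Finset.filter_filter]
    refine add_nonneg ?_ ?_
    · -- ρ: split by fxh
      rw [← Finset.sum_filter_add_sum_filter_not (D.powerset.filter (fun t => (Ev t ∧ ¬ Ev' t) ∧ ρ t)) fxh, Finset.filter_filter, Finset.filter_filter]
      refine add_nonneg ?_ ?_
      · rw [Finset.filter_congr (fun t _ => eqR1 t)]; exact hR1
      · rw [Finset.filter_congr (fun t _ => eqR0 t)]
        by_cases hpW : p ∈ W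
        · have hh : D.powerset.filter (fun t => p ∈ W ∧ cR0 t) = D.powerset.filter cR0 :=
            Finset.filter_congr fun t _ => ⟨fun h => h.2, fun h => ⟨hpW, h⟩⟩
          rw [hh]; exact hR0 hpW
        · have hh : D.powerset.filter (fun t => p ∈ W ∧ cR0 t) = ∅ :=
            Finset.filter_eq_empty_iff.mpr fun t _ h => hpW h.1
          rw [hh, Finset.sum_empty]
    · -- ¬ρ: split by fhh
      rw [← Finset.sum_filter_add_sum_filter_not (D.powerset.filter (fun t => (Ev t ∧ ¬ Ev' t) ∧ ¬ ρ t)) fhh, Finset.filter_filter, Finset.filter_filter]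
      refine add_nonneg ?_ ?_
      · rw [Finset.filter_congr (fun t _ => eqN1 t)]; exact hN1'
      · rw [Finset.filter_congr (fun t _ => eqN0 t)]; exact hN0'
  rw [hsplit]
  exact add_nonneg hS hRes

open Classical in
/-- **THEOREM 0, union form (for general pieces).**  Same as `rem_nonneg_of_pieceRows` but with the two `N`-rows merged into ONE hypothesis
`N`: `0 ≤ Σ_{p∉K₀, p∉B₀, ∀w∈W ¬(w∈K₀∧w∈B₀), ∀w∈W ¬(w∈P∧w∈B₀), ∃w∈W, w∈K₀∧w∈P'} F` (no split by the targets in `P ∩ P'`).  This UNION row is the form that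
survives beyond series–parallel pieces (memo CW-SP-gen69 §6: exact-clean on `B − e` for all 2-connected `B` with ≤ 7 vertices, ≤ 12 edges, while the split row `N1` fails from
6 vertices on).  Original docstring of the split form:  Let `e ∈ E` have ends `{x,p}`, `p ≠ x`, `D = E.erase e`, `K₀ = C_x t`, `P = C_p t`, `B₀ = C_x(D∖t)`, `P' = C_p(D∖t)`,
`F t = g(K₀ ∪ P) − g(B₀)`, `g` monotone.  Assume the four PIECE ROWS of `D` (each a sum of `F` over a colouring class of `D`, memo CW-SP-gen69 §1):
`R1`: `0 ≤ Σ_{p∈K₀, p∉B₀, ∀w∈W ¬(w∈K₀∧w∈B₀), ∃w∈W, w≠p ∧ w∈K₀ ∧ w∈P'} F`;  `R0` (only if `p ∈ W`): `0 ≤ Σ_{p∈K₀, p∉B₀, ∀w∈W ¬(w∈K₀∧w∈B₀), ∀w∈W, w≠p → ¬(w∈K₀∧w∈P')} F`;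
`N0`/`N1`: `0 ≤ Σ_{p∉K₀, p∉B₀, ∀w∈W ¬(w∈K₀∧w∈B₀), ∀w∈W ¬(w∈P∧w∈B₀), ∃w∈W, w∈K₀∧w∈P', [¬ / ∃] (w∈W, w≠p, w∈P∧w∈P')} F`.
Then `0 ≤ REM_E(e; x, W)[g]`. [cite: KozmaNitzan2024, Questions 8–9 (§5.5 p. 36) (context)] -/
theorem rem_nonneg_of_pieceRows_union (E : Finset ι) {e : ι} (he : e ∈ E) {x p : V} (hxp : ends e = s(x, p)) (hpx : p ≠ x)
    (W : Set V) (g : Set V → ℝ) (hg : Monotone g)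
    (hR1 : 0 ≤ ∑ t ∈ (E.erase e).powerset.filter (fun t : Finset ι =>
          p ∈ openCluster (ends '' (↑t : Set ι)) x ∧ p ∉ openCluster (ends '' (↑((E.erase e) \ t) : Set ι)) x ∧
          (∀ w ∈ W, ¬ (w ∈ openCluster (ends '' (↑t : Set ι)) x ∧ w ∈ openCluster (ends '' (↑((E.erase e) \ t) : Set ι)) x)) ∧
          (∃ w ∈ W, w ≠ p ∧ w ∈ openCluster (ends '' (↑t : Set ι)) x ∧ w ∈ openCluster (ends '' (↑((E.erase e) \ t) : Set ι)) p)),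
        (g (openCluster (ends '' (↑t : Set ι)) x ∪ openCluster (ends '' (↑t : Set ι)) p) -
          g (openCluster (ends '' (↑((E.erase e) \ t) : Set ι)) x)))
    (hR0 : p ∈ W → 0 ≤ ∑ t ∈ (E.erase e).powerset.filter (fun t : Finset ι =>
          p ∈ openCluster (ends '' (↑t : Set ι)) x ∧ p ∉ openCluster (ends '' (↑((E.erase e) \ t) : Set ι)) x ∧
          (∀ w ∈ W, ¬ (w ∈ openCluster (ends '' (↑t : Set ι)) x ∧ w ∈ openCluster (ends '' (↑((E.erase e) \ t) : Set ι)) x)) ∧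
          (∀ w ∈ W, w ≠ p → ¬ (w ∈ openCluster (ends '' (↑t : Set ι)) x ∧ w ∈ openCluster (ends '' (↑((E.erase e) \ t) : Set ι)) p))),
        (g (openCluster (ends '' (↑t : Set ι)) x ∪ openCluster (ends '' (↑t : Set ι)) p) -
          g (openCluster (ends '' (↑((E.erase e) \ t) : Set ι)) x)))
    (hN : 0 ≤ ∑ t ∈ (E.erase e).powerset.filter (fun t : Finset ι =>
          p ∉ openCluster (ends '' (↑t : Set ι)) x ∧ p ∉ openCluster (ends '' (↑((E.erase e) \ t) : Set ι)) x ∧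
          (∀ w ∈ W, ¬ (w ∈ openCluster (ends '' (↑t : Set ι)) x ∧ w ∈ openCluster (ends '' (↑((E.erase e) \ t) : Set ι)) x)) ∧
          (∀ w ∈ W, ¬ (w ∈ openCluster (ends '' (↑t : Set ι)) p ∧ w ∈ openCluster (ends '' (↑((E.erase e) \ t) : Set ι)) x)) ∧
          (∃ w ∈ W, w ∈ openCluster (ends '' (↑t : Set ι)) x ∧ w ∈ openCluster (ends '' (↑((E.erase e) \ t) : Set ι)) p)),
        (g (openCluster (ends '' (↑t : Set ι)) x ∪ openCluster (ends '' (↑t : Set ι)) p) -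
          g (openCluster (ends '' (↑((E.erase e) \ t) : Set ι)) x))) :
    0 ≤ ∑ s ∈ E.powerset.filter (fun s : Finset ι => e ∈ s ∧
          ∀ w ∈ W, ¬ (w ∈ openCluster (ends '' (↑s : Set ι)) x ∧ w ∈ openCluster (ends '' (↑(E \ s) : Set ι)) x)),
      (g (openCluster (ends '' (↑s : Set ι)) x) - g (openCluster (ends '' (↑(E \ s) : Set ι)) x)) := by
  rw [rem_eq_sum_erase ends E he hxp hpx W g]
  set D : Finset ι := E.erase e with hD
  -- abbreviations: K t = C_x(t), Pc t = C_p(t); B₀ = K (D \ t), P' = Pc (D \ t)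
  set K : Finset ι → Set V := fun t => openCluster (ends '' (↑t : Set ι)) x with hK
  set Pc : Finset ι → Set V := fun t => openCluster (ends '' (↑t : Set ι)) p with hPc
  set F : Finset ι → ℝ := fun t => g (K t ∪ Pc t) - g (K (D \ t)) with hF
  -- the event and its colour swap
  set Ev : Finset ι → Prop := fun t => ∀ w ∈ W, ¬ (w ∈ K t ∪ Pc t ∧ w ∈ K (D \ t)) with hEv
  set Ev' : Finset ι → Prop := fun t => ∀ w ∈ W, ¬ (w ∈ K (D \ t) ∪ Pc (D \ t) ∧ w ∈ K t) with hEv'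
  change 0 ≤ ∑ t ∈ D.powerset.filter Ev, F t
  -- basic cluster facts
  have hPsubK : ∀ t : Finset ι, p ∈ K t → Pc t ⊆ K t := fun t hp => openCluster_subset_of_mem ends hp
  have hpP : ∀ t : Finset ι, p ∈ Pc t := fun t => mem_openCluster_self _ p
  -- split off the complement-closed part
  have hsplit : ∑ t ∈ D.powerset.filter Ev, F t =
      ∑ t ∈ D.powerset.filter (fun t => Ev t ∧ Ev' t), F t + ∑ t ∈ D.powerset.filter (fun t => Ev t ∧ ¬ Ev' t), F t := by
    rw [← Finset.filter_filter, ← Finset.filter_filter, Finset.sum_filter_add_sum_filter_not]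
  -- PART S: the complement-closed part is ≥ 0 by the colour swap
  have hS : 0 ≤ ∑ t ∈ D.powerset.filter (fun t => Ev t ∧ Ev' t), F t := by
    have hsym : ∀ s, s ⊆ D → ((Ev (D \ s) ∧ Ev' (D \ s)) ↔ (Ev s ∧ Ev' s)) := by
      intro s hs
      have h1 : Ev (D \ s) ↔ Ev' s := by
        simp only [hEv, hEv', Finset.sdiff_sdiff_eq_self hs]
      have h2 : Ev' (D \ s) ↔ Ev s := by
        simp only [hEv, hEv', Finset.sdiff_sdiff_eq_self hs]
      rw [h1, h2]; exact and_comm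
    have hflip := sum_powerset_filter_sdiff (E := D) (Q := fun t => Ev t ∧ Ev' t) hsym (fun t => g (K t))
    have hrew : ∑ t ∈ D.powerset.filter (fun t => Ev t ∧ Ev' t), F t =
        ∑ t ∈ D.powerset.filter (fun t => Ev t ∧ Ev' t), (g (K t ∪ Pc t) - g (K t)) := by
      simp only [hF]
      rw [Finset.sum_sub_distrib, Finset.sum_sub_distrib, hflip]
    rw [hrew]
    exact Finset.sum_nonneg fun t _ => sub_nonneg.mpr (hg Set.subset_union_left)
  -- the residual: Ev t ∧ ¬ Ev' t.  First consequences.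
  have res_nb : ∀ t : Finset ι, Ev t → ¬ Ev' t → p ∉ K (D \ t) := by
    intro t hEvt hnEv' hpB
    apply hnEv'
    intro w hw hh
    obtain ⟨hw1, hw2⟩ := hh
    have hwB : w ∈ K (D \ t) := by
      rcases hw1 with h1 | h1
      · exact h1
      · exact hPsubK (D \ t) hpB h1
    exact hEvt w hw ⟨Or.inl hw2, hwB⟩
  have res_wit : ∀ t : Finset ι, Ev t → ¬ Ev' t → ∃ w ∈ W, w ∈ K t ∧ w ∈ Pc (D \ t) := by
    intro t hEvt hnEv'
    by_contra hne
    push Not at hne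
    apply hnEv'
    intro w hw hh
    obtain ⟨hw1, hw2⟩ := hh
    rcases hw1 with h1 | h1
    · exact hEvt w hw ⟨Or.inl hw2, h1⟩
    · exact hne w hw hw2 h1
  -- class predicates
  set ρ : Finset ι → Prop := fun t => p ∈ K t with hρ
  set fxh : Finset ι → Prop := fun t => ∃ w ∈ W, w ≠ p ∧ w ∈ K t ∧ w ∈ Pc (D \ t) with hfxh
  set cR1 : Finset ι → Prop := fun t => p ∈ K t ∧ p ∉ K (D \ t) ∧ (∀ w ∈ W, ¬ (w ∈ K t ∧ w ∈ K (D \ t))) ∧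
      (∃ w ∈ W, w ≠ p ∧ w ∈ K t ∧ w ∈ Pc (D \ t)) with hcR1
  set cR0 : Finset ι → Prop := fun t => p ∈ K t ∧ p ∉ K (D \ t) ∧ (∀ w ∈ W, ¬ (w ∈ K t ∧ w ∈ K (D \ t))) ∧
      (∀ w ∈ W, w ≠ p → ¬ (w ∈ K t ∧ w ∈ Pc (D \ t))) with hcR0
  set cN : Finset ι → Prop := fun t => p ∉ K t ∧ p ∉ K (D \ t) ∧ (∀ w ∈ W, ¬ (w ∈ K t ∧ w ∈ K (D \ t))) ∧
      (∀ w ∈ W, ¬ (w ∈ Pc t ∧ w ∈ K (D \ t))) ∧ (∃ w ∈ W, w ∈ K t ∧ w ∈ Pc (D \ t)) with hcN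
  change 0 ≤ ∑ t ∈ D.powerset.filter cR1, F t at hR1
  change p ∈ W → 0 ≤ ∑ t ∈ D.powerset.filter cR0, F t at hR0
  change 0 ≤ ∑ t ∈ D.powerset.filter cN, F t at hN
  -- residual ∧ ρ ∧ fxh  =  class R1
  have eqR1 : ∀ t : Finset ι, ((Ev t ∧ ¬ Ev' t) ∧ ρ t) ∧ fxh t ↔ cR1 t := by
    intro t; constructor
    · rintro ⟨⟨⟨hEvt, hnEv'⟩, hr⟩, hf⟩
      exact ⟨hr, res_nb t hEvt hnEv', fun w hw hh => hEvt w hw ⟨Or.inl hh.1, hh.2⟩, hf⟩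
    · rintro ⟨hr, hnb, hEvK, hf⟩
      refine ⟨⟨⟨fun w hw hh => ?_, fun hEv't => ?_⟩, hr⟩, hf⟩
      · obtain ⟨hw1, hw2⟩ := hh
        rcases hw1 with h1 | h1
        · exact hEvK w hw ⟨h1, hw2⟩
        · exact hEvK w hw ⟨hPsubK t hr h1, hw2⟩
      · obtain ⟨w, hw, -, hwK, hwP'⟩ := hf
        exact hEv't w hw ⟨Or.inr hwP', hwK⟩
  -- residual ∧ ρ ∧ ¬fxh  =  [p ∈ W] ∧ class R0
  have eqR0 : ∀ t : Finset ι, ((Ev t ∧ ¬ Ev' t) ∧ ρ t) ∧ ¬ fxh t ↔ (p ∈ W ∧ cR0 t) := by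
    intro t; constructor
    · rintro ⟨⟨⟨hEvt, hnEv'⟩, hr⟩, hnf⟩
      have hnf' : ∀ w ∈ W, w ≠ p → ¬ (w ∈ K t ∧ w ∈ Pc (D \ t)) := fun w hw hne hh => hnf ⟨w, hw, hne, hh.1, hh.2⟩
      obtain ⟨w, hw, hwK, hwP'⟩ := res_wit t hEvt hnEv'
      have hwp : w = p := by
        by_contra hne
        exact hnf' w hw hne ⟨hwK, hwP'⟩
      refine ⟨hwp ▸ hw, hr, res_nb t hEvt hnEv', fun w hw hh => hEvt w hw ⟨Or.inl hh.1, hh.2⟩, hnf'⟩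
    · rintro ⟨hpW, hr, hnb, hEvK, hnf'⟩
      refine ⟨⟨⟨fun w hw hh => ?_, fun hEv't => hEv't p hpW ⟨Or.inr (hpP (D \ t)), hr⟩⟩, hr⟩, fun hf => ?_⟩
      · obtain ⟨hw1, hw2⟩ := hh
        rcases hw1 with h1 | h1
        · exact hEvK w hw ⟨h1, hw2⟩
        · exact hEvK w hw ⟨hPsubK t hr h1, hw2⟩
      · obtain ⟨w, hw, hne, hwK, hwP'⟩ := hf
        exact hnf' w hw hne ⟨hwK, hwP'⟩
  -- residual ∧ ¬ρ  =  class N (then split by fhh)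
  have eqN : ∀ t : Finset ι, (Ev t ∧ ¬ Ev' t) ∧ ¬ ρ t ↔ cN t := by
    intro t; constructor
    · rintro ⟨⟨hEvt, hnEv'⟩, hnr⟩
      obtain ⟨w, hw, hwK, hwP'⟩ := res_wit t hEvt hnEv'
      exact ⟨hnr, res_nb t hEvt hnEv', fun w hw hh => hEvt w hw ⟨Or.inl hh.1, hh.2⟩,
        fun w hw hh => hEvt w hw ⟨Or.inr hh.1, hh.2⟩, ⟨w, hw, hwK, hwP'⟩⟩
    · rintro ⟨hnr, hnb, hEvK, hEvP, ⟨w, hw, hwK, hwP'⟩⟩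
      refine ⟨⟨fun w hw hh => ?_, fun hEv't => hEv't w hw ⟨Or.inr hwP', hwK⟩⟩, hnr⟩
      obtain ⟨hw1, hw2⟩ := hh
      rcases hw1 with h1 | h1
      · exact hEvK w hw ⟨h1, hw2⟩
      · exact hEvP w hw ⟨h1, hw2⟩
  -- assemble the residual
  have hRes : 0 ≤ ∑ t ∈ D.powerset.filter (fun t => Ev t ∧ ¬ Ev' t), F t := by
    -- split by ρ
    rw [← Finset.sum_filter_add_sum_filter_not (D.powerset.filter (fun t => Ev t ∧ ¬ Ev' t)) ρ, Finset.filter_filter, Finset.filter_filter]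
    refine add_nonneg ?_ ?_
    · -- ρ: split by fxh
      rw [← Finset.sum_filter_add_sum_filter_not (D.powerset.filter (fun t => (Ev t ∧ ¬ Ev' t) ∧ ρ t)) fxh, Finset.filter_filter, Finset.filter_filter]
      refine add_nonneg ?_ ?_
      · rw [Finset.filter_congr (fun t _ => eqR1 t)]; exact hR1
      · rw [Finset.filter_congr (fun t _ => eqR0 t)]
        by_cases hpW : p ∈ W
        · have hh : D.powerset.filter (fun t => p ∈ W ∧ cR0 t) = D.powerset.filter cR0 :=
            Finset.filter_congr fun t _ => ⟨fun h => h.2, fun h => ⟨hpW, h⟩⟩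
          rw [hh]; exact hR0 hpW
        · have hh : D.powerset.filter (fun t => p ∈ W ∧ cR0 t) = ∅ :=
            Finset.filter_eq_empty_iff.mpr fun t _ h => hpW h.1
          rw [hh, Finset.sum_empty]
    · -- ¬ρ: the union N-row
      rw [Finset.filter_congr (fun t _ => eqN t)]; exact hN
  rw [hsplit]
  exact add_nonneg hS hRes

end pieceRows

end Coefficientwise

end Summit.CriticalPhenomena.PercolationContinuityZ3.Theorems
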